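import Summits.QuantumFields.YangMills.Theorems.FluctuationComparisonRegPrIntLS2BetaFaceSpreadCurlCount
import Summits.QuantumFields.YangMills.Theorems.FluctuationComparisonRegPrIntLS2BetaQuaternionReadDictionary
import Summits.QuantumFields.YangMills.Theorems.FluctuationComparisonRegPrIntLS2BetaChartReadDescentOntoT3
import HarnessLib

/-!
# S2β ∕ GAP♯∘ strata residue, (RINV-curl) — THE LOCAL CLOSING: AT A GOOD HISTORY `U₀`, EVERY COARSE TANGENT HAS A `DMq(U₀)`-PREIMAGE WITH SMALL COVARIANT CURL,
# for ANY root-trivial transporter with thin interior cycles and ANY sup bound on `DMq` (T³ record, quaternion-read currency; DEFINITION-FREE)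

Cell `ym3-torus` (YM ladder rung R3 = continuum `SU(2)` Yang–Mills on the three-torus — a RUNG: NOT d = 4, NOT infinite volume,
NOT a mass gap, NOT Clay).  Width seat «width 16» `ym3-torus-px16` (gen 22), FREE px helper on crux `stmt-QuantumFields-20520`
(`FluctuationComparisonRegPrIntL`), count-neutral, DEFINITION-FREE (0 `def`, 0 `instance`, 0 `notation`, 0 `sorry`), default heartbeats.

WHAT.  The (RINV-curl) door ✓`…S2BetaPreimagesOfFaceSpreads.exists_preimage_curl_of_faceSpreads` INSTANTIATED on the T³ record in the (PRE) currency of ✓p824141 ∕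
✓`…S2BetaPreOfLetters` (`DMq(U₀) := fderiv (ζ B ↦ imVec (su2Quat (descendTo … (expPoint ζ·U₀) B·(descendTo … U₀ B)⁻¹))) 0`, ✓`…S2BetaCritMQuaternionRead`):
★★★ `exists_preimage_curl_local` — at `U₀ ∈ histGood F ℰp θ K J` under the dictionary guard (`(5L)²∕4·θ_i ≤ α ≤ 1∕24`, `α < δ_{SU(2)}`, `157α < L⁻²`), with plaquettes within
`θ₀` of `1`, for ANY family of transporters `H_x : T_η → SU(2)` (one per `(K−J)`-block `x`) which are `1` at the block centres and whose interior cycles are `δ_I`-thin, and ANY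
constant `A_D` with `‖(DMq ζ) B‖ ≤ A_D‖ζ‖_∞` (px13 g25's (D2) ✓∕⧗`…QuaternionReadDerivKStepSup.norm_qfderiv_apply_le`), provided `A_D·2δ_I ≤ ½`:
  **`∀ v, ∃ ζ, DMq ζ = v ∧ Σ_p ‖(curl_{U₀} ζ)_p‖ ≤ 2·4(d−1)·(N^{d−2} + (θ₀ + δ_I)N^{d−1})·Σ_B ‖v B‖`**, `N = L^{K−J}`.
The face data fed to the door: `X_B w := Ad_{H(b₋)⁻¹} w` on the bonds from `B^k(x)` to `B^k(x + e_μ)` (`⟨x, μ⟩ = bondShift B`), `u_B w := (DMq I_B w)(B)` with the interior part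
`I_B w := Ad_{H(b₋)⁻¹} w − Ad_{U₀ b} Ad_{H(b₊)⁻¹} w` on the bonds inside `B^k(x)`;
  (i) `DMq (X_B w) = e_B ⊗ (w − u_B w)` — §2: (B3′) ✓`…FacePreimageIdentity` read through the dictionary ✓`…QuaternionReadDictionary` (§1: `Ad` ↔ conjugation in Pauli
      coordinates, `coord_adSU2`), block locality off the face bond;
  (ii) `‖u_B w‖ ≤ ½‖w‖` — `A_D` × the interior defect `‖I_B w‖_∞ ≤ 2δ_I‖w‖` (✓`…FaceSpreadCurlCount.norm_adSU2_sub_adSU2_le`);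
  (iii) the face curl count ✓`…FaceSpreadCurlCount.faceSpread_curlCount_le`.
The comb of px13 g25 (✓∕⧗`…S2BetaCombTransporter.dist1_comb_cycle_le`, `holAt_comb_root`), (D2) and the BKG∕threshold numerics enter only in the prefix file (next).

HONEST SCOPE.  Plumbing of landed doors; (B4b), (D2) and the smallness `A_D·2δ_I ≤ ½` are HYPOTHESES here; nothing of Bałaban's analysis is asserted; (RINV-curl)_q in the
registry prefix, MULT♮, AVG₂♭-ax, «CRIT-ax», (D-ax), GAP♯∘ (`stub_uniformFibreGapOrbit`; registry `Lines/semiclassical_s2beta.lean` 3732b7df UNTOUCHED), the five registered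
stubs, S2β, crux 20520, 19936, 19200 and `YM3TorusSU2` are NOT proved; no registered stub is closed; the Yang–Mills mass gap is NOT proved.  Sorry-free, axioms standard.

References: T. Bałaban, CMP **98** (1985) 17–51 [Balaban1985Averaging] ((11)–(13) p.19, (125) p.36, Sect. D (139)–(147) pp.39–40: the right inverse of the linearised
averaging); CMP **102** (1985) 277–309 [Balaban1985Variational] ((34) p.283); CMP **109** (1987) 249–301 [Balaban1987RG1] ((0.4), (0.11) p.253); CMP **102** (1985)
255–275 [Balaban1985UV3] ((7) p.257, p.260).
-/

set_option autoImplicit false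

noncomputable section

open scoped Matrix.Norms.L2Operator Topology Quaternion
open Filter Set Function Finset
open Literature.MathematicalPhysics.QuantumLattice (su2Quat quatMatrix quatMatrix_mul quatMatrix_su2Quat)
open Literature.MathematicalPhysics.QuantumFieldTheory.Balaban1983to89.T4HaarSU2Translate (su2Quat_mul su2Quat_one)
open Literature.MathematicalPhysics.QuantumFieldTheory.Balaban1983to89
open Literature.MathematicalPhysics.QuantumFieldTheory.Balaban1983to89.HaarExponentialChart
open Literature.MathematicalPhysics.QuantumFieldTheory.Balaban1983to89.HaarExponentialChart.IsChartRep
open Literature.MathematicalPhysics.QuantumFieldTheory.Balaban1983to89.BlockAveraging (blockAvg)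
open Literature.MathematicalPhysics.QuantumFieldTheory.Balaban1983to89.ExpMeanLog (expMeanLogSU deltaSU)
open Literature.MathematicalPhysics.QuantumFieldTheory.Balaban1983to89.Node00 hiding blockIter
open Literature.MathematicalPhysics.QuantumFieldTheory.Balaban1983to89.T3ContinuumYM3Torus
open Literature.MathematicalPhysics.QuantumFieldTheory.Balaban1983to89.T3UnitLawDensityEML (ℰp)
open Literature.MathematicalPhysics.QuantumFieldTheory.Balaban1983to89.T3UnitScaleTilt
open Literature.MathematicalPhysics.QuantumFieldTheory.Balaban1983to89.T3TiltDescent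
open Literature.MathematicalPhysics.QuantumFieldTheory.Balaban1983to89.T3LevelShift (fieldShift bondShift)
open Literature.MathematicalPhysics.QuantumFieldTheory.Balaban1983to89.T4HaarSU2ExpChart (expPoint imQuat)
open Literature.MathematicalPhysics.QuantumFieldTheory.Balaban1983to89.T4ExpWindowSmallField (imVec)
open Literature.MathematicalPhysics.QuantumFieldTheory.Balaban1983to89.B15Prop1ChartSU2 (adSU2)
open Literature.MathematicalPhysics.QuantumFieldTheory.Balaban1983to89.B15Prop1ChartCalculusSU2 (imQuat_adSU2 adSU2_adSU2 adSU2_one_apply)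
open Literature.MathematicalPhysics.QuantumFieldTheory.Balaban1983to89.B10Eq18SigmaSU2 (su2Coord su2Coord_injective)
open Literature.MathematicalPhysics.QuantumFieldTheory.Balaban1983to89.B10Eq18SigmaSU2Haar (rev quatMatrix_imQuat)
open Literature.MathematicalPhysics.QuantumFieldTheory.Balaban1983to89.B14.Eq22Determines (blockIter)
open Literature.MathematicalPhysics.QuantumFieldTheory.Balaban1983to89.B15DeterminingSets (embIter)
open Literature.MathematicalPhysics.QuantumFieldTheory.Balaban1983to89.B15Eq177GaugeInvariance (blockIter_embIter)
open Literature.MathematicalPhysics.QuantumFieldTheory.Balaban1983to89.T4Continuum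
open Summit.QuantumFields.YangMills.Theorems.FluctuationComparisonRegPrIntLS2BetaChartReadDescentOntoExpPoint (su2Coord_rev_mem_lie)
open Summit.QuantumFields.YangMills.Theorems.FluctuationComparisonRegPrIntLS2BetaChartReadDescentOntoT3 (smallBelow_of_histGood)
open Summit.QuantumFields.YangMills.Theorems.FluctuationComparisonRegPrIntLS2BetaQuaternionReadDictionary
  (coe_coord_qfderiv_apply qfderiv_apply_eq_zero_of_forall)
open Summit.QuantumFields.YangMills.Theorems.FluctuationComparisonRegPrIntLS2BetaFacePreimageIdentity
  (shift_eq_shift_iff ne_shift_self shift_shift_ne_self coe_fderiv_chartRead_iter_facePart_apply_self)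
open Summit.QuantumFields.YangMills.Theorems.FluctuationComparisonRegPrIntLS2BetaPreimagesOfFaceSpreads (exists_preimage_curl_of_faceSpreads)
open Summit.QuantumFields.YangMills.Theorems.FluctuationComparisonRegPrIntLS2BetaFaceSpreadCurlCount (norm_adSU2_sub_adSU2_le faceSpread_curlCount_le)

namespace Summit.QuantumFields.YangMills.Theorems.FluctuationComparisonRegPrIntLS2BetaFacePreimageLocal

/-! ## §1 Pauli coordinates: `Ad` is conjugation, and the coordinate map is additive -/

/-- `su2Coord (rev 0) = 0`. [folklore] -/
theorem coord_zero : su2Coord (rev (0 : EuclideanSpace ℝ (Fin 3))) = 0 := by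
  rw [← quatMatrix_imQuat, map_zero, ← sub_self (imQuat 0), T4QuatExpLog.quatMatrix_sub, sub_self]

/-- The reversed Pauli coordinate map is additive: `su2Coord (rev (a − b)) = su2Coord (rev a) − su2Coord (rev b)` (through `quatMatrix ∘ imQuat`). [folklore] -/
theorem coord_sub (a b : EuclideanSpace ℝ (Fin 3)) : su2Coord (rev (a - b)) = su2Coord (rev a) - su2Coord (rev b) := by
  rw [← quatMatrix_imQuat, ← quatMatrix_imQuat, ← quatMatrix_imQuat, map_sub, T4QuatExpLog.quatMatrix_sub]

/-- ★ **`Ad` IS CONJUGATION IN PAULI COORDINATES**: `su2Coord (rev (Ad_g v)) = g · su2Coord (rev v) · g*` (`quatMatrix` is multiplicative, `quatMatrix (su2Quat g) = g`,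
`ι(Ad_g v) = q·ιv·q⁻¹`). [cite: Balaban1989LargeFieldI, (1.77) p.194; Balaban1985UV3, p. 260] -/
theorem coord_adSU2 (g : SU 2) (v : EuclideanSpace ℝ (Fin 3)) :
    su2Coord (rev (adSU2 g v)) = (g : Matrix (Fin 2) (Fin 2) ℂ) * su2Coord (rev v) * star (g : Matrix (Fin 2) (Fin 2) ℂ) := by
  have hinv : (su2Quat g)⁻¹ = su2Quat g⁻¹ :=
    (eq_inv_of_mul_eq_one_right (by rw [← su2Quat_mul, mul_inv_cancel, su2Quat_one])).symm
  rw [← quatMatrix_imQuat, ← quatMatrix_imQuat, imQuat_adSU2, quatMatrix_mul, quatMatrix_mul, hinv, quatMatrix_su2Quat, quatMatrix_su2Quat]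
  rfl

/-! ## §2 The face-preimage identity and block locality in the quaternion-read currency -/

section QRead

variable {F : T3Family}

/-- ★★ **OFF THE FACE BOND THE FACE SPREAD IS INVISIBLE TO `DMq`**: for `B′ ≠ B`, `(DMq X)(B′) = 0` for every fine tangent `X` supported on the bonds from `B^{K−J}(x)` to
`B^{K−J}(x + e_μ)`, `⟨x, μ⟩ = bondShift B` (block locality ✓`qfderiv_apply_eq_zero_of_forall` + three blocks per direction, as in (B3′)
✓`fderiv_chartRead_iter_faceSupported_apply_of_ne`). [cite: Balaban1985Averaging, p.19 (locality); Balaban1987RG1, (0.3)-(0.4) pp.252-253] -/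
theorem qfderiv_faceSupported_apply_of_ne {J K : ℕ} (hJK : J ≤ K) {θ : ℕ → ℝ} (hθ0 : ∀ i, 0 ≤ θ i) {α : ℝ}
    (hθα : ∀ i, J < i → i ≤ K → (((5 * F.L : ℕ) : ℝ) ^ 2 / 4) * θ i ≤ α)
    (hα24 : α ≤ 1 / 24) (hαδ : α < deltaSU (Fin 2)) (hαL : 157 * α < ((F.L : ℝ) ^ 2)⁻¹)
    {U₀ : GaugeField (F.P K) 0 (SU 2)} (hUg : U₀ ∈ histGood F ℰp θ K J)
    {B B' : PBond (F.P J) 0} (hne : B' ≠ B) (X : PBond (F.P K) 0 → EuclideanSpace ℝ (Fin 3))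
    (hX : ∀ b : PBond (F.P K) 0,
      ¬ (blockIter (K - J) b.src = (bondShift (F.sitesPerDir_eq (m := F.m) (K := J) (j := 0) (m' := F.m) (K' := K) (j' := K - J) (by omega)) B).src ∧
          blockIter (K - J) b.tgt = (bondShift (F.sitesPerDir_eq (m := F.m) (K := J) (j := 0) (m' := F.m) (K' := K) (j' := K - J) (by omega)) B).src.shift
            (bondShift (F.sitesPerDir_eq (m := F.m) (K := J) (j := 0) (m' := F.m) (K' := K) (j' := K - J) (by omega)) B).dir) → X b = 0) :
    fderiv ℝ (fun (ζ : PBond (F.P K) 0 → EuclideanSpace ℝ (Fin 3)) (B : PBond (F.P J) 0) =>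
        imVec (su2Quat (descendTo F ℰp J K hJK (fun ℓ => expPoint (ζ ℓ) * U₀ ℓ) B * (descendTo F ℰp J K hJK U₀ B)⁻¹))) 0 X B' = 0 := by
  have hk1 : K - J + 1 ≤ (F.P K).m + (F.P K).K := by show K - J + 1 ≤ F.m + K; have := F.hm; omega
  set σ := F.sitesPerDir_eq (m := F.m) (K := J) (j := 0) (m' := F.m) (K' := K) (j' := K - J) (by omega) with hσ
  set x := (bondShift σ B).src with hx
  set μ := (bondShift σ B).dir with hμ
  refine qfderiv_apply_eq_zero_of_forall hJK hθ0 hθα hα24 hαδ hαL hUg X B' fun b hs ht => ?_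
  by_contra hXb
  have hface : blockIter (K - J) b.src = x ∧ blockIter (K - J) b.tgt = x.shift μ := by
    by_contra h; exact hXb (hX b h)
  obtain ⟨h1, h2⟩ := hface
  rw [h1] at hs; rw [h2] at ht
  have htgt : (bondShift σ B').tgt = (bondShift σ B').src.shift (bondShift σ B').dir := rfl
  have hBB : bondShift σ B' ≠ bondShift σ B := fun h => hne ((bondShift σ).injective h)
  rcases hs with hs | hs <;> rcases ht with ht | ht
  · exact (ne_shift_self x μ).symm (ht.trans hs.symm)
  · apply hBB
    rw [htgt, ← hs] at ht
    have hd : μ = (bondShift σ B').dir := (shift_eq_shift_iff x μ _).1 ht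
    calc bondShift σ B' = ⟨(bondShift σ B').src, (bondShift σ B').dir⟩ := rfl
      _ = ⟨x, μ⟩ := by rw [← hs, ← hd]
      _ = bondShift σ B := rfl
  · rw [htgt, ← ht] at hs
    exact shift_shift_ne_self hk1 x μ _ hs.symm
  · exact (ne_shift_self x μ).symm (ht.trans hs.symm)

set_option maxHeartbeats 400000 in
/-- ★★★ **THE FACE-PREIMAGE IDENTITY FOR `DMq`**: at a good history `U₀`, for a transporter `H : T_η → SU(2)` with `H(ι_k x) = 1` (`k = K − J`, `⟨x, μ⟩ = bondShift B`), the face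
spread `X` (`Ad_{H(b₋)⁻¹} w` on the bonds from `B^k(x)` to `B^k(x + e_μ)`, else `0`) and the interior part `I` (`Ad_{H(b₋)⁻¹} w − Ad_{U₀ b} Ad_{H(b₊)⁻¹} w` on the bonds inside
`B^k(x)`, else `0`) of the infinitesimal gauge transformation generated by `λ(z) = Ad_{H(z)⁻¹} w·𝟙_{B^k(x)}(z)` satisfy `(DMq X)(B) = w − (DMq I)(B)` ((B3′) in Pauli coordinates
via §1 and the dictionary). [cite: Balaban1985Averaging, (11)-(13) p.19, (125) p.36; Balaban1987RG1, (0.4), (0.11) p.253; Balaban1985UV3, p. 260] -/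
theorem qfderiv_facePart_apply_self {J K : ℕ} (hJK : J ≤ K) {θ : ℕ → ℝ} (hθ0 : ∀ i, 0 ≤ θ i) {α : ℝ}
    (hθα : ∀ i, J < i → i ≤ K → (((5 * F.L : ℕ) : ℝ) ^ 2 / 4) * θ i ≤ α)
    (hα24 : α ≤ 1 / 24) (hαδ : α < deltaSU (Fin 2)) (hαL : 157 * α < ((F.L : ℝ) ^ 2)⁻¹)
    {U₀ : GaugeField (F.P K) 0 (SU 2)} (hUg : U₀ ∈ histGood F ℰp θ K J) (B : PBond (F.P J) 0)
    (H : Site (F.P K) 0 → SU 2)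
    (hH1 : H (embIter (K - J) (bondShift (F.sitesPerDir_eq (m := F.m) (K := J) (j := 0) (m' := F.m) (K' := K) (j' := K - J) (by omega)) B).src) = 1)
    (w : EuclideanSpace ℝ (Fin 3)) (X I : PBond (F.P K) 0 → EuclideanSpace ℝ (Fin 3))
    (hX : ∀ b : PBond (F.P K) 0, X b =
      if blockIter (K - J) b.src = (bondShift (F.sitesPerDir_eq (m := F.m) (K := J) (j := 0) (m' := F.m) (K' := K) (j' := K - J) (by omega)) B).src ∧
          blockIter (K - J) b.tgt = (bondShift (F.sitesPerDir_eq (m := F.m) (K := J) (j := 0) (m' := F.m) (K' := K) (j' := K - J) (by omega)) B).src.shift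
            (bondShift (F.sitesPerDir_eq (m := F.m) (K := J) (j := 0) (m' := F.m) (K' := K) (j' := K - J) (by omega)) B).dir
      then adSU2 (H b.src)⁻¹ w else 0)
    (hI : ∀ b : PBond (F.P K) 0, I b =
      if blockIter (K - J) b.src = (bondShift (F.sitesPerDir_eq (m := F.m) (K := J) (j := 0) (m' := F.m) (K' := K) (j' := K - J) (by omega)) B).src ∧
          blockIter (K - J) b.tgt = (bondShift (F.sitesPerDir_eq (m := F.m) (K := J) (j := 0) (m' := F.m) (K' := K) (j' := K - J) (by omega)) B).src
      then adSU2 (H b.src)⁻¹ w - adSU2 (U₀ b) (adSU2 (H b.tgt)⁻¹ w) else 0) :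
    fderiv ℝ (fun (ζ : PBond (F.P K) 0 → EuclideanSpace ℝ (Fin 3)) (B : PBond (F.P J) 0) =>
        imVec (su2Quat (descendTo F ℰp J K hJK (fun ℓ => expPoint (ζ ℓ) * U₀ ℓ) B * (descendTo F ℰp J K hJK U₀ B)⁻¹))) 0 X B =
      w - fderiv ℝ (fun (ζ : PBond (F.P K) 0 → EuclideanSpace ℝ (Fin 3)) (B : PBond (F.P J) 0) =>
        imVec (su2Quat (descendTo F ℰp J K hJK (fun ℓ => expPoint (ζ ℓ) * U₀ ℓ) B * (descendTo F ℰp J K hJK U₀ B)⁻¹))) 0 I B := by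
  classical
  have hk : K - J ≤ (F.P K).m + (F.P K).K := by show K - J ≤ F.m + K; omega
  have hk1 : K - J + 1 ≤ (F.P K).m + (F.P K).K := by show K - J + 1 ≤ F.m + K; have := F.hm; omega
  have hθδ : ∀ i, J < i → i ≤ K → (((5 * F.L : ℕ) : ℝ) ^ 2 / 4) * θ i < deltaSU (Fin 2) := fun i hi hiK => (hθα i hi hiK).trans_lt hαδ
  have hsb := smallBelow_of_histGood (F := F) hθ0 hθδ hUg
  set σ := F.sitesPerDir_eq (m := F.m) (K := J) (j := 0) (m' := F.m) (K' := K) (j' := K - J) (by omega) with hσ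
  set x := (bondShift σ B).src with hx
  set μ := (bondShift σ B).dir with hμ
  set DMq := fderiv ℝ (fun (ζ : PBond (F.P K) 0 → EuclideanSpace ℝ (Fin 3)) (B : PBond (F.P J) 0) =>
        imVec (su2Quat (descendTo F ℰp J K hJK (fun ℓ => expPoint (ζ ℓ) * U₀ ℓ) B * (descendTo F ℰp J K hJK U₀ B)⁻¹))) 0 with hDMq
  -- the generator and the chart direction in Pauli coordinates
  set lamv : Site (F.P K) 0 → EuclideanSpace ℝ (Fin 3) := fun z => if blockIter (K - J) z = x then adSU2 (H z)⁻¹ w else 0 with hlamv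
  set lam : Site (F.P K) 0 → (specialUnitaryLogChart (Fin 2)).lie := fun z => ⟨su2Coord (rev (lamv z)), su2Coord_rev_mem_lie _⟩ with hlam
  set Adot : PBond (F.P K) 0 → (specialUnitaryLogChart (Fin 2)).lie :=
    fun b => ⟨su2Coord (rev (lamv b.src - adSU2 (U₀ b) (lamv b.tgt))), su2Coord_rev_mem_lie _⟩ with hAdot
  have hlam0 : ∀ z : Site (F.P K) 0, blockIter (K - J) z ≠ x → lam z = 0 := by
    intro z hz
    apply Subtype.ext
    show su2Coord (rev (lamv z)) = ((0 : (specialUnitaryLogChart (Fin 2)).lie) : Matrix (Fin 2) (Fin 2) ℂ)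
    rw [hlamv]; simp only [hz, if_false]
    rw [coord_zero, ZeroMemClass.coe_zero]
  have hAdot' : ∀ b : PBond (F.P K) 0, (Adot b : Matrix (Fin 2) (Fin 2) ℂ) =
      (lam b.src : Matrix (Fin 2) (Fin 2) ℂ) - (U₀ b : Matrix (Fin 2) (Fin 2) ℂ) * (lam b.tgt : Matrix (Fin 2) (Fin 2) ℂ) * star (U₀ b : Matrix (Fin 2) (Fin 2) ℂ) := by
    intro b
    show su2Coord (rev (lamv b.src - adSU2 (U₀ b) (lamv b.tgt))) = su2Coord (rev (lamv b.src)) - _ * su2Coord (rev (lamv b.tgt)) * _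
    rw [coord_sub, coord_adSU2]
  -- (B3′) in Pauli coordinates
  have hB3 := coe_fderiv_chartRead_iter_facePart_apply_self (P := F.P K) (N := 2) U₀ hk1 hsb x μ lam hlam0 Adot hAdot'
  -- the coordinate fields of `X` and `I` are the face and interior parts of `Adot`
  have hXc : (fun b : PBond (F.P K) 0 => (⟨su2Coord (rev (X b)), su2Coord_rev_mem_lie (X b)⟩ : (specialUnitaryLogChart (Fin 2)).lie)) =
      fun b => if blockIter (K - J) b.src = x ∧ blockIter (K - J) b.tgt = x.shift μ then Adot b else 0 := by
    funext b
    apply Subtype.ext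
    show su2Coord (rev (X b)) = ((if blockIter (K - J) b.src = x ∧ blockIter (K - J) b.tgt = x.shift μ then Adot b else 0 :
      (specialUnitaryLogChart (Fin 2)).lie) : Matrix (Fin 2) (Fin 2) ℂ)
    rw [hX b]
    split_ifs with hb
    · have h1 : lamv b.src = adSU2 (H b.src)⁻¹ w := by rw [hlamv]; simp only [hb.1, if_true]
      have h2 : lamv b.tgt = 0 := by
        rw [hlamv]; simp only
        rw [if_neg]; rw [hb.2]; exact (ne_shift_self x μ).symm
      show su2Coord (rev (adSU2 (H b.src)⁻¹ w)) = su2Coord (rev (lamv b.src - adSU2 (U₀ b) (lamv b.tgt)))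
      rw [h1, h2, map_zero, sub_zero]
    · rw [coord_zero, ZeroMemClass.coe_zero]
  have hIc : (fun b : PBond (F.P K) 0 => (⟨su2Coord (rev (I b)), su2Coord_rev_mem_lie (I b)⟩ : (specialUnitaryLogChart (Fin 2)).lie)) =
      fun b => if blockIter (K - J) b.src = x ∧ blockIter (K - J) b.tgt = x then Adot b else 0 := by
    funext b
    apply Subtype.ext
    show su2Coord (rev (I b)) = ((if blockIter (K - J) b.src = x ∧ blockIter (K - J) b.tgt = x then Adot b else 0 :
      (specialUnitaryLogChart (Fin 2)).lie) : Matrix (Fin 2) (Fin 2) ℂ)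
    rw [hI b]
    split_ifs with hb
    · have h1 : lamv b.src = adSU2 (H b.src)⁻¹ w := by rw [hlamv]; simp only [hb.1, if_true]
      have h2 : lamv b.tgt = adSU2 (H b.tgt)⁻¹ w := by rw [hlamv]; simp only [hb.2, if_true]
      show su2Coord (rev (adSU2 (H b.src)⁻¹ w - adSU2 (U₀ b) (adSU2 (H b.tgt)⁻¹ w))) = su2Coord (rev (lamv b.src - adSU2 (U₀ b) (lamv b.tgt)))
      rw [h1, h2]
    · rw [coord_zero, ZeroMemClass.coe_zero]
  -- the root value `λ(ι_k x) = w` in coordinates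
  have hroot : (lam (embIter (K - J) x) : Matrix (Fin 2) (Fin 2) ℂ) = su2Coord (rev w) := by
    show su2Coord (rev (lamv (embIter (K - J) x))) = su2Coord (rev w)
    rw [hlamv]; simp only [blockIter_embIter (K - J) hk, if_true]
    rw [hH1, inv_one, adSU2_one_apply]
  -- the dictionary on `X` and on `I`
  have hDX := coe_coord_qfderiv_apply (F := F) hJK hθ0 hθα hα24 hαδ hαL hUg X B
  have hDI := coe_coord_qfderiv_apply (F := F) hJK hθ0 hθα hα24 hαδ hαL hUg I B
  rw [hXc] at hDX
  rw [hIc] at hDI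
  have hBx : bondShift σ B = ⟨x, μ⟩ := rfl
  rw [← hσ, hBx] at hDX hDI
  -- assemble: `coord(DMq X B) = coord(w) − coord(DMq I B) = coord(w − DMq I B)`
  have hcoord : su2Coord (rev (DMq X B)) = su2Coord (rev (w - DMq I B)) := by
    rw [coord_sub, hDMq, hDX, hDI, ← hroot]
    exact hB3
  exact rev.injective (WithLp.ofLp_injective 2 (su2Coord_injective hcoord))

end QRead

/-! ## §3 The local closing -/

section Local

variable {F : T3Family}

set_option maxHeartbeats 400000 in
/-- ★★★ **THE LOCAL (RINV-curl) AT A GOOD HISTORY, FOR ANY ROOT-TRIVIAL THIN TRANSPORTER AND ANY SUP BOUND ON `DMq`.**  At `U₀ ∈ histGood F ℰp θ K J` under the dictionary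
guard, with every plaquette within `θ₀` of `1`, transporters `H_x` (`H_x(ι_{K−J} x) = 1`, interior cycles `δ_I`-thin), `‖(DMq ζ) B‖ ≤ A_D·‖ζ‖_∞` and `A_D·2δ_I ≤ ½`:
every coarse tangent `v` has `ζ` with `DMq ζ = v` and `Σ_p ‖(curl_{U₀} ζ)_p‖ ≤ 2·4(d−1)·((L^{K−J})^{d−2} + (θ₀ + δ_I)(L^{K−J})^{d−1})·Σ_B ‖v B‖` — the door
✓`exists_preimage_curl_of_faceSpreads` fed with (i) `qfderiv_facePart_apply_self` ∕ `qfderiv_faceSupported_apply_of_ne`, (ii) the interior defect, (iii) the face curl count.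
[cite: Balaban1985Averaging, (125) p.36, Sect. D (139)-(147) pp.39-40; Balaban1985Variational, (34) p.283; Balaban1987RG1, (0.4), (0.11) p.253] -/
theorem exists_preimage_curl_local {J K : ℕ} (hJK : J ≤ K) {θ : ℕ → ℝ} (hθ0 : ∀ i, 0 ≤ θ i) {α : ℝ}
    (hθα : ∀ i, J < i → i ≤ K → (((5 * F.L : ℕ) : ℝ) ^ 2 / 4) * θ i ≤ α)
    (hα24 : α ≤ 1 / 24) (hαδ : α < deltaSU (Fin 2)) (hαL : 157 * α < ((F.L : ℝ) ^ 2)⁻¹)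
    {U₀ : GaugeField (F.P K) 0 (SU 2)} (hUg : U₀ ∈ histGood F ℰp θ K J)
    {θ₀ δI AD : ℝ} (hθ₀ : 0 ≤ θ₀) (hδI : 0 ≤ δI) (hAD : 0 ≤ AD)
    (hU : ∀ q : Plaq (F.P K) 0, dist1 (GaugeField.plaqHol U₀ q) ≤ θ₀)
    (H : Site (F.P K) (K - J) → Site (F.P K) 0 → SU 2) (hH1 : ∀ x : Site (F.P K) (K - J), H x (embIter (K - J) x) = 1)
    (hW : ∀ (x : Site (F.P K) (K - J)) (z : Site (F.P K) 0) (κ : Fin (F.P K).d),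
      blockIter (K - J) z = x → blockIter (K - J) (z.shift κ) = x → dist1 (H x z * U₀ ⟨z, κ⟩ * (H x (z.shift κ))⁻¹) ≤ δI)
    (hD2 : ∀ (ζ : PBond (F.P K) 0 → EuclideanSpace ℝ (Fin 3)) (B : PBond (F.P J) 0),
      ‖fderiv ℝ (fun (ζ : PBond (F.P K) 0 → EuclideanSpace ℝ (Fin 3)) (B : PBond (F.P J) 0) =>
          imVec (su2Quat (descendTo F ℰp J K hJK (fun ℓ => expPoint (ζ ℓ) * U₀ ℓ) B * (descendTo F ℰp J K hJK U₀ B)⁻¹))) 0 ζ B‖ ≤ AD * ‖ζ‖)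
    (hsmall : AD * (2 * δI) ≤ 1 / 2) (v : PBond (F.P J) 0 → EuclideanSpace ℝ (Fin 3)) :
    ∃ ζ : PBond (F.P K) 0 → EuclideanSpace ℝ (Fin 3),
      fderiv ℝ (fun (ζ : PBond (F.P K) 0 → EuclideanSpace ℝ (Fin 3)) (B : PBond (F.P J) 0) =>
          imVec (su2Quat (descendTo F ℰp J K hJK (fun ℓ => expPoint (ζ ℓ) * U₀ ℓ) B * (descendTo F ℰp J K hJK U₀ B)⁻¹))) 0 ζ = v ∧
      ∑ p : Plaq (F.P K) 0, ‖adSU2 (GaugeField.plaqHol U₀ p)⁻¹ (ζ ⟨p.src, p.μ⟩) + adSU2 ((GaugeField.plaqHol U₀ p)⁻¹ * U₀ ⟨p.src, p.μ⟩) (ζ ⟨p.src.shift p.μ, p.ν⟩) -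
          adSU2 ((GaugeField.plaqHol U₀ p)⁻¹ * U₀ ⟨p.src, p.μ⟩ * U₀ ⟨p.src.shift p.μ, p.ν⟩ * (U₀ ⟨p.src.shift p.ν, p.μ⟩)⁻¹) (ζ ⟨p.src.shift p.ν, p.μ⟩) -
          ζ ⟨p.src, p.ν⟩‖ ≤
        2 * (4 * (((F.P K).d : ℝ) - 1) * ((((F.P K).L : ℝ) ^ (K - J)) ^ ((F.P K).d - 2) + (θ₀ + δI) * (((F.P K).L : ℝ) ^ (K - J)) ^ ((F.P K).d - 1))) *
          ∑ B : PBond (F.P J) 0, ‖v B‖ := by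
  classical
  have hk1 : K - J + 1 ≤ (F.P K).m + (F.P K).K := by show K - J + 1 ≤ F.m + K; have := F.hm; omega
  set σ := F.sitesPerDir_eq (m := F.m) (K := J) (j := 0) (m' := F.m) (K' := K) (j' := K - J) (by omega) with hσ
  set D : (PBond (F.P K) 0 → EuclideanSpace ℝ (Fin 3)) →L[ℝ] (PBond (F.P J) 0 → EuclideanSpace ℝ (Fin 3)) :=
    fderiv ℝ (fun (ζ : PBond (F.P K) 0 → EuclideanSpace ℝ (Fin 3)) (B : PBond (F.P J) 0) =>
      imVec (su2Quat (descendTo F ℰp J K hJK (fun ℓ => expPoint (ζ ℓ) * U₀ ℓ) B * (descendTo F ℰp J K hJK U₀ B)⁻¹))) 0 with hD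
  -- the face spreads, interior parts and defects
  set X : PBond (F.P J) 0 → EuclideanSpace ℝ (Fin 3) →ₗ[ℝ] (PBond (F.P K) 0 → EuclideanSpace ℝ (Fin 3)) := fun B =>
    LinearMap.pi fun b : PBond (F.P K) 0 =>
      if blockIter (K - J) b.src = (bondShift σ B).src ∧ blockIter (K - J) b.tgt = (bondShift σ B).src.shift (bondShift σ B).dir
      then adSU2 (H (bondShift σ B).src b.src)⁻¹ else 0 with hXdef
  set I : PBond (F.P J) 0 → EuclideanSpace ℝ (Fin 3) →ₗ[ℝ] (PBond (F.P K) 0 → EuclideanSpace ℝ (Fin 3)) := fun B =>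
    LinearMap.pi fun b : PBond (F.P K) 0 =>
      if blockIter (K - J) b.src = (bondShift σ B).src ∧ blockIter (K - J) b.tgt = (bondShift σ B).src
      then adSU2 (H (bondShift σ B).src b.src)⁻¹ - (adSU2 (U₀ b)).comp (adSU2 (H (bondShift σ B).src b.tgt)⁻¹) else 0 with hIdef
  set u : PBond (F.P J) 0 → EuclideanSpace ℝ (Fin 3) →ₗ[ℝ] EuclideanSpace ℝ (Fin 3) := fun B =>
    (LinearMap.proj B).comp ((D : (PBond (F.P K) 0 → EuclideanSpace ℝ (Fin 3)) →ₗ[ℝ] (PBond (F.P J) 0 → EuclideanSpace ℝ (Fin 3))).comp (I B)) with hudef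
  have hXapp : ∀ (B : PBond (F.P J) 0) (w : EuclideanSpace ℝ (Fin 3)) (b : PBond (F.P K) 0), X B w b =
      if blockIter (K - J) b.src = (bondShift σ B).src ∧ blockIter (K - J) b.tgt = (bondShift σ B).src.shift (bondShift σ B).dir
      then adSU2 (H (bondShift σ B).src b.src)⁻¹ w else 0 := by
    intro B w b
    rw [hXdef]; simp only [LinearMap.pi_apply]
    split_ifs <;> simp
  have hIapp : ∀ (B : PBond (F.P J) 0) (w : EuclideanSpace ℝ (Fin 3)) (b : PBond (F.P K) 0), I B w b =
      if blockIter (K - J) b.src = (bondShift σ B).src ∧ blockIter (K - J) b.tgt = (bondShift σ B).src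
      then adSU2 (H (bondShift σ B).src b.src)⁻¹ w - adSU2 (U₀ b) (adSU2 (H (bondShift σ B).src b.tgt)⁻¹ w) else 0 := by
    intro B w b
    rw [hIdef]; simp only [LinearMap.pi_apply]
    split_ifs <;> simp
  have huapp : ∀ (B : PBond (F.P J) 0) (w : EuclideanSpace ℝ (Fin 3)), u B w = D (I B w) B := by
    intro B w; rw [hudef]; simp
  -- (i) the face identity
  have hDM : ∀ (B : PBond (F.P J) 0) (w : EuclideanSpace ℝ (Fin 3)),
      (D : (PBond (F.P K) 0 → EuclideanSpace ℝ (Fin 3)) →ₗ[ℝ] (PBond (F.P J) 0 → EuclideanSpace ℝ (Fin 3))) (X B w) = Pi.single B (w - u B w) := by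
    intro B w
    rw [ContinuousLinearMap.coe_coe]
    funext B'
    by_cases hB : B' = B
    · subst hB
      rw [Pi.single_eq_same, huapp, hD]
      exact qfderiv_facePart_apply_self hJK hθ0 hθα hα24 hαδ hαL hUg B' (H (bondShift σ B').src) (hH1 _) w (X B' w) (I B' w) (hXapp B' w) (hIapp B' w)
    · rw [Pi.single_eq_of_ne hB, hD]
      exact qfderiv_faceSupported_apply_of_ne hJK hθ0 hθα hα24 hαδ hαL hUg hB (X B w) fun b hb => by rw [hXapp, if_neg hb]
  -- (ii) the contracting defect
  have hu : ∀ (B : PBond (F.P J) 0) (w : EuclideanSpace ℝ (Fin 3)), ‖u B w‖ ≤ ‖w‖ / 2 := by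
    intro B w
    have hIn : ‖I B w‖ ≤ 2 * δI * ‖w‖ := by
      refine (pi_norm_le_iff_of_nonneg (by positivity)).2 fun b => ?_
      rw [hIapp]
      split_ifs with hb
      · obtain ⟨s, κ⟩ := b
        rw [adSU2_adSU2]
        refine (norm_adSU2_sub_adSU2_le _ _ w).trans ?_
        rw [inv_inv, ← mul_assoc]
        exact mul_le_mul_of_nonneg_right (mul_le_mul_of_nonneg_left (hW _ s κ hb.1 hb.2) (by norm_num)) (norm_nonneg w)
      · rw [norm_zero]; positivity
    rw [huapp]
    calc ‖D (I B w) B‖ ≤ AD * ‖I B w‖ := hD2 (I B w) B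
      _ ≤ AD * (2 * δI * ‖w‖) := mul_le_mul_of_nonneg_left hIn hAD
      _ = AD * (2 * δI) * ‖w‖ := by ring
      _ ≤ 1 / 2 * ‖w‖ := mul_le_mul_of_nonneg_right hsmall (norm_nonneg w)
      _ = ‖w‖ / 2 := by ring
  -- (iii) the face curl count
  have hXc : ∀ (B : PBond (F.P J) 0) (w : EuclideanSpace ℝ (Fin 3)),
      ∑ p : Plaq (F.P K) 0, ‖adSU2 (GaugeField.plaqHol U₀ p)⁻¹ (X B w ⟨p.src, p.μ⟩) +
          adSU2 ((GaugeField.plaqHol U₀ p)⁻¹ * U₀ ⟨p.src, p.μ⟩) (X B w ⟨p.src.shift p.μ, p.ν⟩) -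
          adSU2 ((GaugeField.plaqHol U₀ p)⁻¹ * U₀ ⟨p.src, p.μ⟩ * U₀ ⟨p.src.shift p.μ, p.ν⟩ * (U₀ ⟨p.src.shift p.ν, p.μ⟩)⁻¹) (X B w ⟨p.src.shift p.ν, p.μ⟩) -
          X B w ⟨p.src, p.ν⟩‖ ≤
        4 * (((F.P K).d : ℝ) - 1) * ((((F.P K).L : ℝ) ^ (K - J)) ^ ((F.P K).d - 2) + (θ₀ + δI) * (((F.P K).L : ℝ) ^ (K - J)) ^ ((F.P K).d - 1)) * ‖w‖ :=
    fun B w => faceSpread_curlCount_le hk1 U₀ (H (bondShift σ B).src) (bondShift σ B).src (bondShift σ B).dir hθ₀ hδI hU (hW _) w (X B w) (hXapp B w)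
  obtain ⟨ζ, hζ, hcurl⟩ := exists_preimage_curl_of_faceSpreads U₀
    (D : (PBond (F.P K) 0 → EuclideanSpace ℝ (Fin 3)) →ₗ[ℝ] (PBond (F.P J) 0 → EuclideanSpace ℝ (Fin 3))) X u hDM hu hXc v
  refine ⟨ζ, ?_, hcurl⟩
  rw [ContinuousLinearMap.coe_coe, hD] at hζ
  exact hζ

end Local

end Summit.QuantumFields.YangMills.Theorems.FluctuationComparisonRegPrIntLS2BetaFacePreimageLocal

end
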